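/-
Copyright (c) 2026. All rights reserved.
Released under Apache 2.0 license as described in the file LICENSE.
Authors: abc-iut cell, seat abc-iut-f-069 (gen 7; row «CT2b / G-L4t6g8-2 residual»).
-/
import Literature.GroupTheory.CombinatorialGroupTheory.FoxPathChains
import Mathlib.Data.ZMod.QuotientGroup
import Mathlib.GroupTheory.Perm.Basic
import Mathlib.Dynamics.PeriodicPts.Defs
import HarnessLib

/-!
# Fox path chains, II: pushforward along group homomorphisms and the orbit-count vanishing test

Lyndon–Schupp, *Combinatorial Group Theory*, Ch. II §3 (Fox calculus; the chain of a word in a quotient `G = F/R`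
is the IMAGE of its chain in any finer quotient) [cite: LyndonSchupp2001, Ch. II §3].

GADGET + PROOF file (classical, self-contained; ONE group of definitions — the pushforward — and one counting lemma;
no `Prop` definitions, no instances, no notation), abc-iut-f-069 (gen 7).  Continues `FoxPathChains.lean`
(abc-iut-f-069 gen 5): there the Fox derivations of `F(a,b) → G` were packaged as the homomorphism into the Fox group
`W G k = (k^G × k^G) ⋊ G`.  Here:

* `FoxChain.push π f` — the pushforward of a coefficient function `f : G → k` along a map `π : G → G'` of finite
  types (`(push π f) g' = Σ_{π g = g'} f g`, i.e. the image of `Σ f(g)·g ∈ k[G]` in `k[G']`); it commutes with left and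
  right translations along a homomorphism (`push_lt`, `push_rt`), sends indicators to indicators (`push_e`), and along a
  bijection is re-indexing (`push_apply_of_bijective`);
* `FoxChain.mapW π : W G k →* W G' k` — **functoriality of the Fox group** in the group along a homomorphism
  `π : G →* G'` (`((f₁,f₂), g) ↦ ((π_* f₁, π_* f₂), π g)`), with `mapW_wa : mapW π (wa A) = wa (π A)` and `mapW_wb` — so
  the Fox homomorphism of a COARSER quotient is `mapW π ∘` the Fox homomorphism of a finer one, and an automorphism
  of `G` fixing the generators' images transports Fox chains;
* `FoxChain.sum_eq_zero_of_dvd_minimalPeriod` — **the orbit-count vanishing test**: if a permutation `τ` of a finite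
  type preserves a finite set `F`, a coefficient function `f` is `τ`-invariant, and every `τ`-orbit in `F` has length
  divisible by `ℓ` with `(ℓ : k) = 0`, then `Σ_{h ∈ F} f h = 0` (the sum is `Σ_orbits |orbit| · value`).
These are consumed by `AbsTopII/DehnTwistFoxLevelChains.lean` / `DehnTwistAffineOrbits.lean` (level-by-level Fox
chains of an element of `F̂₂` and their vanishing under a free pro-cyclic dynamics).  Classical combinatorial group
theory; nothing here bears on [IUTchIII] Cor 3.12.
-/

namespace Literature.GroupTheory.CombinatorialGroupTheory.FoxChain

open Function

/-! ### Pushforward of coefficient functions -/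

section Push

variable {G G' : Type*} {k : Type*}

/-- **Pushforward of a coefficient function** along a map of finite types: `(push π f) g' = Σ_{g : π g = g'} f g`
(the image of `Σ_g f(g)·g ∈ k[G]` under `k[G] → k[G']`). [cite: LyndonSchupp2001, Ch. II §3] -/
def push [Fintype G] [DecidableEq G'] [AddCommMonoid k] (π : G → G') (f : G → k) : G' → k :=
  fun g' => ∑ g ∈ Finset.univ.filter (fun g => π g = g'), f g

variable [Fintype G] [DecidableEq G']

/-- Unfolding `push`. [cite: LyndonSchupp2001, Ch. II §3] -/
theorem push_apply [AddCommMonoid k] (π : G → G') (f : G → k) (g' : G') :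
    push π f g' = ∑ g ∈ Finset.univ.filter (fun g => π g = g'), f g := rfl

/-- `push` is additive. [cite: LyndonSchupp2001, Ch. II §3] -/
theorem push_add [AddCommMonoid k] (π : G → G') (f f' : G → k) : push π (f + f') = push π f + push π f' := by
  funext g'; simp [push_apply, Finset.sum_add_distrib]

/-- `push 0 = 0`. [cite: LyndonSchupp2001, Ch. II §3] -/
theorem push_zero [AddCommMonoid k] (π : G → G') : push π (0 : G → k) = 0 := by
  funext g'; simp [push_apply]

/-- `push` commutes with negation. [cite: LyndonSchupp2001, Ch. II §3] -/
theorem push_neg [AddCommGroup k] (π : G → G') (f : G → k) : push π (-f) = -push π f := by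
  funext g'; simp [push_apply, Finset.sum_neg_distrib]

/-- `push` commutes with subtraction. [cite: LyndonSchupp2001, Ch. II §3] -/
theorem push_sub [AddCommGroup k] (π : G → G') (f f' : G → k) : push π (f - f') = push π f - push π f' := by
  rw [sub_eq_add_neg, push_add, push_neg, ← sub_eq_add_neg]

/-- `push` commutes with finite sums. [cite: LyndonSchupp2001, Ch. II §3] -/
theorem push_sum [AddCommMonoid k] {ι : Type*} (s : Finset ι) (π : G → G') (f : ι → G → k) :
    push π (∑ j ∈ s, f j) = ∑ j ∈ s, push π (f j) := by
  classical
  induction s using Finset.induction_on with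
  | empty => simp [push_zero]
  | insert a s ha ih => rw [Finset.sum_insert ha, Finset.sum_insert ha, push_add, ih]

/-- The pushforward of an indicator is the indicator of the image: `π_* e_g = e_{π g}`. [cite: LyndonSchupp2001, Ch. II §3] -/
theorem push_e [DecidableEq G] [AddCommMonoidWithOne k] (π : G → G') (g : G) :
    push π (e g : G → k) = e (π g) := by
  funext g'
  simp only [push_apply, e]
  by_cases h : g' = π g
  · rw [if_pos h, Finset.sum_eq_single g]
    · rw [if_pos rfl]
    · intro x hx hxg
      rw [if_neg hxg]
    · intro hg
      exact absurd (by simp [h]) hg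
  · rw [if_neg h]
    refine Finset.sum_eq_zero fun x hx => ?_
    simp only [Finset.mem_filter, Finset.mem_univ, true_and] at hx
    rw [if_neg]
    rintro rfl
    exact h hx.symm

/-- Along a homomorphism, `push` commutes with left translation: `π_* (λ_g f) = λ_{π g} (π_* f)`. [cite: LyndonSchupp2001, Ch. II §3] -/
theorem push_lt [Group G] [Group G'] [AddCommMonoid k] (π : G →* G') (g : G) (f : G → k) :
    push π (lt g f) = lt (π g) (push π f) := by
  funext g'
  simp only [push_apply, lt_apply]
  refine Finset.sum_nbij' (fun q => g⁻¹ * q) (fun q => g * q) ?_ ?_ ?_ ?_ ?_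
  · intro q hq
    simp only [Finset.mem_filter, Finset.mem_univ, true_and] at hq ⊢
    rw [map_mul, map_inv, hq]
  · intro q hq
    simp only [Finset.mem_filter, Finset.mem_univ, true_and] at hq ⊢
    rw [map_mul, hq, mul_inv_cancel_left]
  · intro q _; simp
  · intro q _; simp
  · intro q _; rfl

/-- Along a homomorphism, `push` commutes with right translation: `π_* (ρ_h f) = ρ_{π h} (π_* f)`. [cite: LyndonSchupp2001, Ch. II §3] -/
theorem push_rt [Group G] [Group G'] [AddCommMonoid k] (π : G →* G') (h : G) (f : G → k) :
    push π (rt h f) = rt (π h) (push π f) := by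
  funext g'
  simp only [push_apply, rt_apply]
  refine Finset.sum_nbij' (fun q => q * h⁻¹) (fun q => q * h) ?_ ?_ ?_ ?_ ?_
  · intro q hq
    simp only [Finset.mem_filter, Finset.mem_univ, true_and] at hq ⊢
    rw [map_mul, map_inv, hq]
  · intro q hq
    simp only [Finset.mem_filter, Finset.mem_univ, true_and] at hq ⊢
    rw [map_mul, hq, inv_mul_cancel_right]
  · intro q _; simp
  · intro q _; simp
  · intro q _; rfl

/-- Along a bijection `push` is re-indexing: `(π_* f) (π g) = f g`. [cite: LyndonSchupp2001, Ch. II §3] -/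
theorem push_apply_of_injective [AddCommMonoid k] (π : G → G') (hπ : Injective π) (f : G → k) (g : G) :
    push π f (π g) = f g := by
  rw [push_apply]
  have : (Finset.univ.filter fun x => π x = π g) = {g} := by
    ext x
    simp only [Finset.mem_filter, Finset.mem_univ, true_and, Finset.mem_singleton]
    exact ⟨fun h => hπ h, fun h => by rw [h]⟩
  rw [this, Finset.sum_singleton]

/-- Along a bijection `push` is re-indexing by the inverse: `π_* f = f ∘ π⁻¹`. [cite: LyndonSchupp2001, Ch. II §3] -/
theorem push_equiv_apply [AddCommMonoid k] (π : G ≃ G') (f : G → k) (g' : G') :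
    push π f g' = f (π.symm g') := by
  conv_lhs => rw [← π.apply_symm_apply g']
  exact push_apply_of_injective π π.injective f _

/-- Transitivity: `(π' ∘ π)_* = π'_* ∘ π_*`. [cite: LyndonSchupp2001, Ch. II §3] -/
theorem push_push {G'' : Type*} [Fintype G'] [DecidableEq G''] [AddCommMonoid k] (π : G → G') (π' : G' → G'')
    (f : G → k) : push π' (push π f) = push (π' ∘ π) f := by
  funext g''
  simp only [push_apply, Function.comp_apply]
  have hmaps : ∀ g ∈ (Finset.univ.filter fun g : G => π' (π g) = g''),
      π g ∈ (Finset.univ.filter fun g' : G' => π' g' = g'') := by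
    intro g hg
    simp only [Finset.mem_filter, Finset.mem_univ, true_and] at hg ⊢
    exact hg
  rw [← Finset.sum_fiberwise_of_maps_to hmaps]
  refine Finset.sum_congr rfl fun g' hg' => Finset.sum_congr ?_ fun _ _ => rfl
  ext g
  simp only [Finset.mem_filter, Finset.mem_univ, true_and] at hg' ⊢
  constructor
  · intro h
    exact ⟨by rw [h]; exact hg', h⟩
  · rintro ⟨_, h⟩
    exact h

/-- The total coefficient sum is preserved by `push`: `csum_{univ} (π_* f) = csum_{univ} f`. [cite: LyndonSchupp2001, Ch. II §3] -/
theorem sum_push [Fintype G'] [AddCommMonoid k] (π : G → G') (f : G → k) :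
    ∑ g', push π f g' = ∑ g, f g := by
  simp only [push_apply]
  have hmaps : ∀ g ∈ (Finset.univ : Finset G), π g ∈ (Finset.univ : Finset G') := fun _ _ => Finset.mem_univ _
  rw [← Finset.sum_fiberwise_of_maps_to hmaps]

/-- The coefficient sum of `π_* f` over a set `S'` is the coefficient sum of `f` over `π⁻¹ S'`. [cite: LyndonSchupp2001, Ch. II §3] -/
theorem csum_push [AddCommMonoid k] (π : G → G') (f : G → k) (S' : Finset G') (S : Finset G)
    (hS : ∀ g, g ∈ S ↔ π g ∈ S') : csum S' (push π f) = csum S f := by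
  simp only [csum_apply, push_apply]
  have hmaps : ∀ g ∈ S, π g ∈ S' := fun g hg => (hS g).1 hg
  rw [← Finset.sum_fiberwise_of_maps_to hmaps]
  refine Finset.sum_congr rfl fun g' hg' => Finset.sum_congr ?_ fun _ _ => rfl
  ext g
  simp only [Finset.mem_filter, Finset.mem_univ, true_and]
  constructor
  · intro h
    exact ⟨(hS g).2 (by rw [h]; exact hg'), h⟩
  · rintro ⟨_, h⟩
    exact h

/-- Reindexing: the coefficient sum of `λ_g f` over `S` is the coefficient sum of `f` over `g⁻¹·S` (any `T` with
`q ∈ S ↔ g⁻¹ q ∈ T`). [cite: LyndonSchupp2001, Ch. II §3] -/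
theorem csum_lt {G : Type*} [Group G] {k : Type*} [AddCommMonoid k] (S T : Finset G) (g : G)
    (hST : ∀ q, q ∈ S ↔ g⁻¹ * q ∈ T) (f : G → k) : csum S (lt g f) = csum T f := by
  simp only [csum_apply, lt_apply]
  exact Finset.sum_nbij' (fun q => g⁻¹ * q) (fun q => g * q) (fun q hq => (hST q).1 hq)
    (fun q hq => (hST _).2 (by simpa using hq)) (fun q _ => by simp) (fun q _ => by simp) (fun _ _ => rfl)

end Push

/-! ### Functoriality of the Fox group in `G` -/

section MapW

variable {G G' : Type*} [Group G] [Group G'] [Fintype G] [DecidableEq G'] {k : Type*} [CommRing k]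

/-- **Functoriality of the Fox group**: a homomorphism `π : G →* G'` (of finite source) induces
`W G k →* W G' k`, `((f₁, f₂), g) ↦ ((π_* f₁, π_* f₂), π g)`. [cite: LyndonSchupp2001, Ch. II §3] -/
def mapW (π : G →* G') : W G k →* W G' k where
  toFun w := ⟨Multiplicative.ofAdd (push π (Multiplicative.toAdd w.left).1, push π (Multiplicative.toAdd w.left).2),
    π w.right⟩
  map_one' := by
    refine SemidirectProduct.ext ?_ ?_
    · show Multiplicative.ofAdd (push π (0 : V2 G k).1, push π (0 : V2 G k).2) = Multiplicative.ofAdd 0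
      rw [Prod.fst_zero, Prod.snd_zero, push_zero, Prod.mk_zero_zero]
    · show π 1 = 1
      rw [map_one]
  map_mul' w w' := by
    refine SemidirectProduct.ext ?_ ?_
    · apply Multiplicative.toAdd.injective
      simp only [SemidirectProduct.mul_left, toAdd_mul, toAdd_ofAdd, toAdd_foxAct, Prod.fst_add, Prod.snd_add,
        Prod.mk_add_mk, push_add, push_lt]
    · show π (w.right * w'.right) = π w.right * π w'.right
      rw [map_mul]

/-- The `G'`-component of `mapW π w` is `π w.right`. [cite: LyndonSchupp2001, Ch. II §3] -/
theorem mapW_right (π : G →* G') (w : W G k) : (mapW π w).right = π w.right := rfl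

/-- The chain components of `mapW π w` are the pushforwards. [cite: LyndonSchupp2001, Ch. II §3] -/
theorem toAdd_mapW_left (π : G →* G') (w : W G k) :
    Multiplicative.toAdd (mapW π w).left =
      (push π (Multiplicative.toAdd w.left).1, push π (Multiplicative.toAdd w.left).2) := rfl

/-- `mapW π (wa A) = wa (π A)`. [cite: LyndonSchupp2001, Ch. II §3] -/
theorem mapW_wa [DecidableEq G] (π : G →* G') (A : G) : mapW π (wa A : W G k) = wa (π A) := by
  refine SemidirectProduct.ext ?_ rfl
  show Multiplicative.ofAdd (push π (e 1 : G → k), push π (0 : G → k)) = Multiplicative.ofAdd (e 1, 0)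
  rw [push_e, push_zero, map_one]

/-- `mapW π (wb B) = wb (π B)`. [cite: LyndonSchupp2001, Ch. II §3] -/
theorem mapW_wb [DecidableEq G] (π : G →* G') (B : G) : mapW π (wb B : W G k) = wb (π B) := by
  refine SemidirectProduct.ext ?_ rfl
  show Multiplicative.ofAdd (push π (0 : G → k), push π (e 1 : G → k)) = Multiplicative.ofAdd (0, e 1)
  rw [push_e, push_zero, map_one]

/-- `mapW` of a chain-free element `inr g` is `inr (π g)`. [cite: LyndonSchupp2001, Ch. II §3] -/
theorem mapW_inr (π : G →* G') (g : G) :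
    mapW π (SemidirectProduct.inr g : W G k) = SemidirectProduct.inr (π g) := by
  refine SemidirectProduct.ext ?_ rfl
  show Multiplicative.ofAdd (push π (0 : V2 G k).1, push π (0 : V2 G k).2) = 1
  rw [Prod.fst_zero, Prod.snd_zero, push_zero]
  rfl

end MapW

/-! ### The orbit-count vanishing test -/

section OrbitCount

variable {X : Type*} {k : Type*}

/-- `τ (τ⁻¹ y) = y` for a permutation. [cite: LyndonSchupp2001, Ch. II §3] -/
theorem perm_apply_inv_apply (τ : Equiv.Perm X) (y : X) : τ (τ⁻¹ y) = y := by
  rw [Equiv.Perm.inv_def, Equiv.apply_symm_apply]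

/-- `τ⁻¹ (τ y) = y` for a permutation. [cite: LyndonSchupp2001, Ch. II §3] -/
theorem perm_inv_apply_apply (τ : Equiv.Perm X) (y : X) : τ⁻¹ (τ y) = y := by
  rw [Equiv.Perm.inv_def, Equiv.symm_apply_apply]

/-- A `τ`-invariant coefficient function is invariant under every integer power of `τ`. [cite: LyndonSchupp2001, Ch. II §3] -/
theorem apply_zpow_eq_of_invariant (τ : Equiv.Perm X) {f : X → k} (hf : ∀ x, f (τ x) = f x) (j : ℤ) (x : X) :
    f ((τ ^ j) x) = f x := by
  have hn : ∀ (n : ℕ) (y : X), f ((τ ^ n) y) = f y := by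
    intro n
    induction n with
    | zero => intro y; simp
    | succ n ih => intro y; rw [pow_succ, Equiv.Perm.mul_apply, ih, hf]
  obtain ⟨n, rfl | rfl⟩ := j.eq_nat_or_neg
  · exact_mod_cast hn n x
  · have h := hn n ((τ ^ (n : ℤ))⁻¹ x)
    rw [← zpow_natCast, ← Equiv.Perm.mul_apply, mul_inv_cancel, Equiv.Perm.one_apply] at h
    rw [zpow_neg]
    exact h.symm

/-- A `τ`-stable finite set is stable under `τ⁻¹`. [cite: LyndonSchupp2001, Ch. II §3] -/
theorem inv_apply_mem_of_stable (τ : Equiv.Perm X) {F : Finset X} (hF : ∀ x, x ∈ F ↔ τ x ∈ F) {x : X}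
    (hx : x ∈ F) : τ⁻¹ x ∈ F := by
  rw [hF, perm_apply_inv_apply]
  exact hx

/-- A `τ`-stable finite set contains the `τ`-orbit of each of its points. [cite: LyndonSchupp2001, Ch. II §3] -/
theorem zpow_apply_mem_of_stable (τ : Equiv.Perm X) {F : Finset X} (hF : ∀ x, x ∈ F ↔ τ x ∈ F) (j : ℤ) {x : X}
    (hx : x ∈ F) : (τ ^ j) x ∈ F := by
  have hn : ∀ (n : ℕ) (y : X), y ∈ F → (τ ^ n) y ∈ F := by
    intro n
    induction n with
    | zero => intro y hy; simpa using hy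
    | succ n ih => intro y hy; rw [pow_succ, Equiv.Perm.mul_apply]; exact ih _ ((hF y).1 hy)
  have hn' : ∀ (n : ℕ) (y : X), y ∈ F → (τ ^ n)⁻¹ y ∈ F := by
    intro n
    induction n with
    | zero => intro y hy; simpa using hy
    | succ n ih =>
      intro y hy
      rw [pow_succ', mul_inv_rev, Equiv.Perm.mul_apply]
      exact ih _ (inv_apply_mem_of_stable τ hF hy)
  obtain ⟨n, rfl | rfl⟩ := j.eq_nat_or_neg
  · exact_mod_cast hn n x hx
  · rw [zpow_neg, zpow_natCast]
    exact hn' n x hx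

/-- **The orbit-count vanishing test.**  Let `τ` be a permutation of a finite type, `F` a `τ`-stable finite set,
`f` a `τ`-invariant coefficient function with values in `k` where `(ℓ : k) = 0`, and suppose every point of `F` has
`τ`-period divisible by `ℓ`.  Then `Σ_{h ∈ F} f h = 0`: the sum splits over the `τ`-orbits in `F`, each contributing
`|orbit| · (constant value) = 0`. [cite: LyndonSchupp2001, Ch. II §3] -/
theorem sum_eq_zero_of_dvd_minimalPeriod [Finite X] {k : Type*} [CommRing k] {ℓ : ℕ} (hℓ : (ℓ : k) = 0)
    (τ : Equiv.Perm X) (F : Finset X) (hF : ∀ x, x ∈ F ↔ τ x ∈ F) (f : X → k) (hf : ∀ x, f (τ x) = f x)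
    (hper : ∀ x ∈ F, ℓ ∣ Function.minimalPeriod τ x) : ∑ h ∈ F, f h = 0 := by
  classical
  cases nonempty_fintype X
  -- induction on (a bound for) the size of `F`
  suffices key : ∀ (n : ℕ) (F : Finset X), F.card ≤ n → (∀ x, x ∈ F ↔ τ x ∈ F) →
      (∀ x ∈ F, ℓ ∣ Function.minimalPeriod τ x) → ∑ h ∈ F, f h = 0 from key _ F le_rfl hF hper
  intro n
  induction n with
  | zero =>
    intro F hF0 _ _
    rw [Nat.le_zero, Finset.card_eq_zero] at hF0
    rw [hF0, Finset.sum_empty]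
  | succ n ih =>
    intro F hcard hF hper
    rcases F.eq_empty_or_nonempty with rfl | ⟨x, hx⟩
    · simp
    -- the orbit of `x`, as a finite subset of `F`
    set O : Finset X := (MulAction.orbit (Subgroup.zpowers τ) x).toFinset with hO
    have memO : ∀ y, y ∈ O ↔ ∃ j : ℤ, (τ ^ j) x = y := by
      intro y
      rw [hO, Set.mem_toFinset, MulAction.mem_orbit_iff]
      constructor
      · rintro ⟨⟨g, hg⟩, rfl⟩
        obtain ⟨j, rfl⟩ := Subgroup.mem_zpowers_iff.mp hg
        exact ⟨j, rfl⟩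
      · rintro ⟨j, rfl⟩
        exact ⟨⟨τ ^ j, Subgroup.mem_zpowers_iff.mpr ⟨j, rfl⟩⟩, rfl⟩
    have hOF : O ⊆ F := by
      intro y hy
      obtain ⟨j, rfl⟩ := (memO y).1 hy
      exact zpow_apply_mem_of_stable τ hF j hx
    have hxO : x ∈ O := (memO x).2 ⟨0, by simp⟩
    -- the sum over the orbit vanishes: `|O| · f x` with `ℓ ∣ |O|`
    have hcardO : O.card = Function.minimalPeriod τ x := by
      rw [hO, Set.toFinset_card]
      have h := (MulAction.minimalPeriod_eq_card (a := τ) (b := x)).symm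
      have hfun : (fun y : X => τ • y) = ⇑τ := funext fun y => Equiv.Perm.smul_def τ y
      rw [hfun] at h
      convert h
    have hsumO : ∑ h ∈ O, f h = 0 := by
      rw [Finset.sum_eq_card_nsmul (b := f x) (fun y hy => ?_)]
      · rw [hcardO, nsmul_eq_mul]
        obtain ⟨c, hc⟩ := hper x hx
        rw [hc, Nat.cast_mul, hℓ, zero_mul, zero_mul]
      · obtain ⟨j, rfl⟩ := (memO y).1 hy
        exact apply_zpow_eq_of_invariant τ hf j x
    -- the complement is again `τ`-stable, and smaller
    have hOy : ∀ y, y ∈ O ↔ τ y ∈ O := by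
      intro y
      rw [memO, memO]
      constructor
      · rintro ⟨j, rfl⟩
        exact ⟨1 + j, by rw [zpow_one_add, Equiv.Perm.mul_apply]⟩
      · rintro ⟨j, hj⟩
        refine ⟨-1 + j, ?_⟩
        rw [zpow_add, zpow_neg, zpow_one, Equiv.Perm.mul_apply, hj, perm_inv_apply_apply]
    have hF' : ∀ y, y ∈ F \ O ↔ τ y ∈ F \ O := by
      intro y
      rw [Finset.mem_sdiff, Finset.mem_sdiff, ← hF y, ← hOy y]
    have hlt : (F \ O).card ≤ n := by
      have h1 : (F \ O).card < F.card :=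
        Finset.card_lt_card ⟨Finset.sdiff_subset, fun h => (Finset.mem_sdiff.mp (h hx)).2 hxO⟩
      omega
    have hrest := ih (F \ O) hlt hF' (fun y hy => hper y (Finset.mem_sdiff.mp hy).1)
    rw [← Finset.sum_sdiff hOF, hrest, hsumO, add_zero]

end OrbitCount

end Literature.GroupTheory.CombinatorialGroupTheory.FoxChain
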